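import Summits.CriticalPhenomena.PercolationContinuityZ3.Theorems.Transplant.CayleyMilnorTransitive
import HarnessLib

/-!
# The WALL as a Lean hypothesis: modulo the one-type scaled node, Benjamini–Schramm's Conjecture 4 for Cayley graphs (resp. vertex-transitive graphs
# with a finite-stabiliser transitive group) REDUCES to the groups (resp. acting groups) all of whose characters are pairwise dependent (`b₁ ≤ 1`)

builds on p205010 (kernel theorem, internal audit signed; external expert review pending) — nothing in this file uses p205010.  CONDITIONAL on the OPEN
node `SamePDropOfSkeletonFrmScaled₁` (hypothesis `hN`) and on the explicit WALL hypothesis `hwall`; nothing is claimed about either.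
Lane `prim-bschramm`, seat `prim-bschramm-p4` gen 22 (PART C3 of `P4-GENERAL.md` §44).  Helper file (`--supports stmt-CriticalPhenomena-4575 --as helper`).

THE POINT ("be exact about what remains").  The C3 conditional theorem (`CayleyScaled.criticalContinuity_of_two_characters`, gen 17; chart-free
`AutScaled.criticalContinuity`) settles, modulo `U_s`, every Cayley graph of every finitely generated group with two independent characters.  This file
states the residual as a HYPOTHESIS and proves the reduction, so that "the wall" is a Lean formula and not a paragraph:
* **`conj4_cayley_of_frmScaledNode₁_of_wall`**: `U_s` + [Conj. 4 for Cayley graphs of f.g. groups whose characters `Γ → ℤ` are pairwise dependent]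
  ⟹ Conj. 4 for EVERY Cayley graph of EVERY finitely generated group (`p_c < 1 ⟹ θ_g(p_c) = 0`);
* **`conj4_transitive_of_frmScaledNode₁_of_wall`**: the same for connected locally finite graphs with a transitive finite-stabiliser group `A` of
  automorphisms, the wall being the actions whose group `A` has pairwise dependent characters.
What is KNOWN inside the wall (gen 21–22, kernel): `p_c < 1` forces `Γ` (resp. `A`) not virtually cyclic (`VirtCyc`/`AutVirtCyc`/`AutVirtCycQT`);
nilpotent and finite-by-nilpotent groups never lie on the wall (`p_c < 1 ⟹ b₁ ≥ 2`, `CayleyNilpotentBSConj`, `CayleyNilpotentVirtuallyCyclic`); every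
virtually-`ℤ^d` / virtually nilpotent wall group contains `ℤ²`, so its `p_c < 1` is a certificate (`CayleyZSqCriticalProbLtOne`, `NilpotentCommutingPair`);
the closed nodes settle the wall members with enough point symmetry (twisted frames: Hantzsche–Wendt, gen 20).  What is NOT known: a one-type method on
the wall — it is the planner's multi-type / quasi-step end-state node (M)+(Q) (P4 §41.5, §43.2).
[cite: BenjaminiSchramm1996, Conj. 4; §2 (Cayley graphs, almost transitive graphs)] [cite: MilnorSolvableGrowth1968, Lemma 1]
-/

noncomputable section

namespace Summit.CriticalPhenomena.PercolationContinuityZ3.Theorems.Transplant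
open SimpleGraph Literature.Probability.LatticeModels Literature.Probability.Percolation
open scoped Classical

namespace Wall

/-- **REDUCTION (Cayley graphs): modulo the scaled node, Conjecture 4 for all Cayley graphs of all finitely generated groups follows from its WALL
case — the groups all of whose characters are pairwise dependent (`b₁ ≤ 1`).**  The complement is gen 17's
`CayleyScaled.criticalContinuity_of_two_characters`.  CONDITIONAL on `U_s` (`hN`) and on the wall hypothesis (`hwall`).
[cite: BenjaminiSchramm1996, Conj. 4; §2 (Cayley graphs)] -/
theorem conj4_cayley_of_frmScaledNode₁_of_wall (hN : SamePDropOfSkeletonFrmScaled₁)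
    (hwall : ∀ {Γ : Type} [Group Γ] (S : Finset Γ), Subgroup.closure (S : Set Γ) = ⊤ →
      (∀ (ψ₀ ψ₁ : Γ →* Multiplicative ℤ) (a b : Γ),
        Multiplicative.toAdd (ψ₀ a) * Multiplicative.toAdd (ψ₁ b) = Multiplicative.toAdd (ψ₁ a) * Multiplicative.toAdd (ψ₀ b)) →
      ∀ g : Γ, criticalProb (mulCayley (↑S : Set Γ)) g < 1 → theta (mulCayley (↑S : Set Γ)) g (criticalProbIOf (mulCayley (↑S : Set Γ)) g) = 0)
    {Γ : Type} [Group Γ] (S : Finset Γ) (hS : Subgroup.closure (S : Set Γ) = ⊤) (g : Γ) (hpc : criticalProb (mulCayley (↑S : Set Γ)) g < 1) :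
    theta (mulCayley (↑S : Set Γ)) g (criticalProbIOf (mulCayley (↑S : Set Γ)) g) = 0 := by
  by_cases hind : ∃ (ψ₀ ψ₁ : Γ →* Multiplicative ℤ) (a b : Γ),
      Multiplicative.toAdd (ψ₀ a) * Multiplicative.toAdd (ψ₁ b) ≠ Multiplicative.toAdd (ψ₁ a) * Multiplicative.toAdd (ψ₀ b)
  · obtain ⟨ψ₀, ψ₁, a, b, hne⟩ := hind
    exact CayleyScaled.criticalContinuity_of_two_characters hN ψ₀ ψ₁ a b hne S hS g
  · push Not at hind
    exact hwall S hS hind g hpc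

/-- **REDUCTION (vertex-transitive graphs): modulo the scaled node, Conjecture 4 for connected locally finite graphs with a transitive finite-stabiliser
group `A` of automorphisms follows from its WALL case — the actions whose group has pairwise dependent characters.**  The complement is gen 17's
`AutScaled.criticalContinuity`.  CONDITIONAL on `U_s` and on the wall hypothesis. [cite: BenjaminiSchramm1996, Conj. 4; §2 (almost transitive graphs)] -/
theorem conj4_transitive_of_frmScaledNode₁_of_wall (hN : SamePDropOfSkeletonFrmScaled₁)
    (hwall : ∀ {V : Type} {G : SimpleGraph V} [G.LocallyFinite] {A : Type} [Group A] [MulAction A V],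
      IsActionByAut G A → G.Connected → ∀ t : V, (∀ v : V, ∃ a : A, a • t = v) → (MulAction.stabilizer A t : Set A).Finite →
      (∀ (ψ₀ ψ₁ : A →* Multiplicative ℤ) (a b : A),
        Multiplicative.toAdd (ψ₀ a) * Multiplicative.toAdd (ψ₁ b) = Multiplicative.toAdd (ψ₁ a) * Multiplicative.toAdd (ψ₀ b)) →
      ∀ v : V, criticalProb G v < 1 → theta G v (criticalProbIOf G v) = 0)
    {V : Type} {G : SimpleGraph V} [G.LocallyFinite] {A : Type} [Group A] [MulAction A V] (hact : IsActionByAut G A) (hc : G.Connected)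
    (t : V) (htr : ∀ v : V, ∃ a : A, a • t = v) (hfin : (MulAction.stabilizer A t : Set A).Finite) (v : V) (hpc : criticalProb G v < 1) :
    theta G v (criticalProbIOf G v) = 0 := by
  by_cases hind : ∃ (ψ₀ ψ₁ : A →* Multiplicative ℤ) (a b : A),
      Multiplicative.toAdd (ψ₀ a) * Multiplicative.toAdd (ψ₁ b) ≠ Multiplicative.toAdd (ψ₁ a) * Multiplicative.toAdd (ψ₀ b)
  · obtain ⟨ψ₀, ψ₁, a, b, hne⟩ := hind
    exact AutScaled.criticalContinuity hN hact hc t htr hfin (CayleyScaled.pairHom ψ₀ ψ₁)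
      ⟨a, b, by rw [MaxArea.det2, CayleyScaled.toAdd_pairHom_zero, CayleyScaled.toAdd_pairHom_one, CayleyScaled.toAdd_pairHom_zero,
        CayleyScaled.toAdd_pairHom_one]; exact sub_ne_zero.2 hne⟩ v
  · push Not at hind
    exact hwall hact hc t htr hfin hind v hpc

end Wall

end Summit.CriticalPhenomena.PercolationContinuityZ3.Theorems.Transplant
end
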